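/-
Copyright (c) 2026 the pub-hodgecm-mathlib formalisation cell (harness21).  Prover seat hodgecm-mathlib-LH4-p12 (g3), Track A «(D-RAM) FOUR-FRAME», unit U2H, the census leaf
(ρ2b′-X) `stub_U2H_fixedPointCensus_typeTwo_unit0` — PAYER-PLAN-rho2bX v1 brick T1 «norm-residue glue counts», structural half.  2026-09-04.
-/
import Literature.NumberTheory.LocalFields.WildQuadraticDatumNormSignConductor   -- ★ p856540: `exists_unit_v_sub_mul_map_le`, `exists_mul_map_eq_of_fixed_of_v_sub_one_le_pred` (conductor `d`)
import Literature.NumberTheory.LocalFields.WildQuadraticDatumNormOneQuotient      -- ★ `two_le_of_v_two_lt_one`, `v_sub_map_le_of_v_le_one`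
import Literature.NumberTheory.LocalFields.WildQuadraticDatumNormGradedSteps      -- ★ `map_mul_map`, `v_eq_one_of_v_mul_map_eq_one`
import Literature.NumberTheory.LocalFields.UnramifiedQuadraticNormTwistedAntitrace  -- ★ `natCard_lift_quotient_pow_eq_mul` (level lifting of counts on `R ⧸ 𝔪^m`)
import Literature.NumberTheory.Automorphic.UnitaryThreePHTowerRho                   -- ★ `mem_maximalIdeal_pow_iff_v_le` (`y ∈ 𝓂^m ↔ |y| ≤ |ϖ^m|`)
import HarnessLib

/-!
# Norm fibres modulo `𝓂^n` of a WILD ramified quadratic datum: the fibres `{x mod 𝓂^n : x·σ̄x ≡ r}` are equinumerous BELOW the conductor, norm-gated AT and ABOVE it,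
# and `#{x mod 𝓂² : x·σ̄x ≡ 1} = q` (Serre, *Local Fields* V §3; the wild twin of ★ `RamifiedQuadraticNorm.natCard_norm_fibre_quotient_pow_ramified`)

Topic `NumberTheory/LocalFields`; namespace `Literature.NumberTheory.LocalFields.WildQuadraticDatum` (the one-field datum ★ `IsRamifiedQuadraticDatum σ ϖ d t`).  THEOREMS ONLY (no
definition, no instance, no notation, no named fact, no `sorry`); kernel lane `--supports stmt-HodgeConjecture-24833` (count-neutral).  Cell `pub/hodgecm-mathlib` (D-0151), crux
H413, Track A «(D-RAM) FOUR-FRAME», unit U2H: the census leaf (ρ2b′-X) counts `δ`-fixed unimodular lattices; in the toric∕order reduction of that census (LH4-p12 (g3)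
PAYER-PLAN-rho2bX v1 §1 D5–D6) each `λ`-stable plane lattice with discriminant module `𝒪∕ϖ^{2a}` contributes the number of its anti-isometric glues, which is a NORM FIBRE
`A(a, ξ) = #{c ∈ (𝒪∕𝓂^{2a})ˣ : c·σc ≡ ξ}` of a fixed unit `ξ`.  The tame count is ★ `natCard_norm_fibre_quotient_pow_ramified` (`2q^{⌊n∕2⌋}` or `0` by a residue square
class, `|2| = 1`).  THIS FILE is the structural half of the wild count (`|2| < 1`, conductor `d ≥ 2`): with
`Sol_n(r) := {x : 𝒪 ⧸ 𝓂^n // ∃ u, mk u = x ∧ |u·σu − r| ≤ |ϖ^n|}` (the condition is constant on classes, §1),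
* §2 TRANSLATION: `#Sol_n(r) = #Sol_n(r′)` whenever `|z₀σz₀·r − r′| ≤ |ϖ^n|` for some unit `z₀` (`x ↦ x·z̄₀`);
* §3 BELOW THE CONDUCTOR (`a + 1 ≤ d`): **`#Sol_{2a}(r) = #Sol_{2a}(1)` for EVERY fixed unit `r`** (★ `exists_unit_v_sub_mul_map_le`: every fixed unit is a norm to order `2(d−1)`) —
  the glue count is class-BLIND below the conductor;
* §4 AT AND ABOVE (`2d − 1 ≤ n`, `K` complete): **`#Sol_n(r) = #Sol_n(1)` if `r ∈ N(Kˣ)` and `= 0` otherwise** (★ `exists_mul_map_eq_of_fixed_of_v_sub_one_le_pred`: a fixed unit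
  `≡ 1 (mod ϖ^{2d−1})` is a norm);
* §5 THE FIRST VALUE: **`#Sol_2(1) = q`** (`|uσu − 1| ≤ |ϖ|² ⟺ |u − 1| ≤ |ϖ|`, because `d ≥ 2`, `|2| ≤ |ϖ|` and the residue field has characteristic `2`; then ★ level lifting);
* §6 THE LIFTING STEP: for `a ≥ 1`, `#Sol_{2a+2}(1) = q² · #{x : 𝒪 ⧸ 𝓂^{2a} // ∃ u, mk u = x ∧ |uσu − 1| ≤ |ϖ^{2a+2}|}` (the stronger congruence is constant on classes mod
  `𝓂^{2a}`: traces of `𝓂^{2a}` lie in `𝓂^{2a+2}` since `d ≥ 2`, `|2| ≤ |ϖ|²` and fixed elements have even order).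
Sequel ★ `WildQuadraticDatumNormFibreValues` (same seat): the layer count and the VALUES `#Sol_{2a}(1) = q^a` below the conductor (`2q^a` at∕above it is the third brick).
HONEST LABEL: HC_CM is proved only modulo the 7 printed citations (2 remaining named inputs: hLiu418 = stmt-HodgeConjecture-24832, h413 = stmt-HodgeConjecture-24833) until rung 0
closes; unconditional local algebra, count-neutral.

## References
* [Serre1979] J.-P. Serre, *Local Fields*, GTM 67 (1979): Ch. V §3 Prop. 5, Cor. 2–3 pp. 84–86 (norm groups and conductor of a totally ramified cyclic extension of prime
  degree), Ch. IV §2 Prop. 6 (`|(𝒪∕𝔪^k)ˣ|`), Ch. XV §2.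
* [LabesseLanglands1979] J.-P. Labesse, R. P. Langlands, *L-indistinguishability for SL(2)*, Canad. J. Math. 31 (1979), §2 p. 8 (the counts `δ_m` of norm residues).
-/

set_option autoImplicit false

noncomputable section

open WithZero IsLocalRing
open scoped Valued
open Literature.NumberTheory.Automorphic.UnitaryThreeFourFrame
open Literature.NumberTheory.Automorphic.UnitaryGroup (mem_maximalIdeal_pow_iff_v_le)
open Literature.NumberTheory.LocalFields.UnramifiedQuadraticNorm (natCard_lift_quotient_pow_eq_mul natCard_quotient_maximalIdeal_pow)

namespace Literature.NumberTheory.LocalFields.WildQuadraticDatum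

variable {K : Type} [Field K] [Valued K ℤᵐ⁰] {σ : K →+* K} {ϖ : K} {d t : ℕ}
/-! ## §0 Valuation letters -/
/-- `|ϖ^n| < 1` for `n ≥ 1`. [cite: Serre1979, Ch. V §3] -/
theorem v_varpi_pow_lt_one (hϖ : Valued.v ϖ = exp (-1 : ℤ)) {n : ℕ} (hn : 1 ≤ n) : Valued.v (ϖ ^ n) < 1 := by
  rw [map_pow, v_varpi_pow hϖ, ← exp_zero, exp_lt_exp]; omega

/-- A value `< 1` is `≤ |ϖ|` (`|ϖ| = exp(−1)` is the largest value below `1`). [cite: Serre1979, Ch. II §1] -/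
theorem v_le_varpi_of_lt_one (hϖ : Valued.v ϖ = exp (-1 : ℤ)) {y : K} (hy : Valued.v y < 1) : Valued.v y ≤ Valued.v ϖ := by
  rcases eq_or_ne (Valued.v y) 0 with h0 | h0
  · rw [h0]; exact zero_le
  · obtain ⟨n, hn⟩ : ∃ n : ℤ, Valued.v y = exp n := ⟨_, (exp_log h0).symm⟩
    rw [hn] at hy ⊢
    rw [← exp_zero, exp_lt_exp] at hy
    rw [hϖ, exp_le_exp]; omega

/-- Norms of integers are Lipschitz: `|uσu − u′σu′| ≤ |u − u′|` for `|u|, |u′| ≤ 1` (`σ` isometric). [cite: Serre1979, Ch. V §3] -/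
theorem v_mul_map_sub_mul_map_le (hvσ : ∀ a, Valued.v (σ a) = Valued.v a) {u u' : K} (hu : Valued.v u ≤ 1) (hu' : Valued.v u' ≤ 1) :
    Valued.v (u * σ u - u' * σ u') ≤ Valued.v (u - u') := by
  have hrew : u * σ u - u' * σ u' = (u - u') * σ u + u' * σ (u - u') := by rw [map_sub]; ring
  rw [hrew]
  refine (Valuation.map_add _ _ _).trans (max_le ?_ ?_)
  · rw [map_mul, hvσ]; exact mul_le_of_le_one_right' hu
  · rw [map_mul, hvσ, mul_comm]; exact mul_le_of_le_one_right' hu'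

/-- The norm-fibre condition is CONSTANT ON CLASSES: if `|u − u′| ≤ |ϖ^n|` then `|uσu − r| ≤ |ϖ^n| ↔ |u′σu′ − r| ≤ |ϖ^n|`. [cite: Serre1979, Ch. V §3] -/
theorem v_mul_map_sub_le_iff_of_v_sub_le (hvσ : ∀ a, Valued.v (σ a) = Valued.v a) {u u' : K} (hu : Valued.v u ≤ 1) (hu' : Valued.v u' ≤ 1)
    {n : ℕ} (h : Valued.v (u - u') ≤ Valued.v (ϖ ^ n)) (r : K) :
    Valued.v (u * σ u - r) ≤ Valued.v (ϖ ^ n) ↔ Valued.v (u' * σ u' - r) ≤ Valued.v (ϖ ^ n) := by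
  have hN := (v_mul_map_sub_mul_map_le hvσ hu hu').trans h
  have hN' : Valued.v (u' * σ u' - u * σ u) ≤ Valued.v (ϖ ^ n) := by rw [Valuation.map_sub_swap]; exact hN
  constructor
  · intro hc
    have hrew : u' * σ u' - r = (u' * σ u' - u * σ u) + (u * σ u - r) := by ring
    rw [hrew]; exact (Valuation.map_add _ _ _).trans (max_le hN' hc)
  · intro hc
    have hrew : u * σ u - r = (u * σ u - u' * σ u') + (u' * σ u' - r) := by ring
    rw [hrew]; exact (Valuation.map_add _ _ _).trans (max_le hN hc)
/-! ## §1 The fibre predicate on `𝒪 ⧸ 𝓂^n` -/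
/-- The class of `u` lies in `Sol_n(r)` iff `u` itself satisfies the condition (class-independence). [cite: Serre1979, Ch. V §3] -/
theorem exists_mk_eq_iff (hvσ : ∀ a, Valued.v (σ a) = Valued.v a) (hϖ : Valued.v ϖ = exp (-1 : ℤ)) (n : ℕ) (r : K) (u : 𝒪[K]) :
    (∃ u' : 𝒪[K], Ideal.Quotient.mk (𝓂[K] ^ n) u' = Ideal.Quotient.mk (𝓂[K] ^ n) u ∧ Valued.v ((u' : K) * σ u' - r) ≤ Valued.v (ϖ ^ n)) ↔
      Valued.v ((u : K) * σ u - r) ≤ Valued.v (ϖ ^ n) := by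
  constructor
  · rintro ⟨u', hu', hc⟩
    have hsub : u' - u ∈ 𝓂[K] ^ n := (Ideal.Quotient.eq).1 hu'
    rw [mem_maximalIdeal_pow_iff_v_le hϖ] at hsub
    exact (v_mul_map_sub_le_iff_of_v_sub_le hvσ u'.2 u.2 (by simpa using hsub) r).1 hc
  · intro hc; exact ⟨u, rfl, hc⟩
/-! ## §2 Translation by a unit: `#Sol_n(r) = #Sol_n(r′)` when `z₀σz₀·r ≡ r′` -/
/-- **TRANSLATION.** If `z₀` is a unit with `|z₀σz₀·r − r′| ≤ |ϖ^n|` then `x ↦ x·z̄₀` is a bijection `Sol_n(r) ≃ Sol_n(r′)`; in particular the fibres have the same cardinality.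
[cite: Serre1979, Ch. V §3 Prop. 5] [cite: LabesseLanglands1979, §2 p. 8] -/
theorem natCard_normFibre_eq_of_approx (hvσ : ∀ a, Valued.v (σ a) = Valued.v a)
    (n : ℕ) {r r' z₀ : K} (hz₀ : Valued.v z₀ = 1) (h : Valued.v (z₀ * σ z₀ * r - r') ≤ Valued.v (ϖ ^ n)) :
    Nat.card {x : 𝒪[K] ⧸ 𝓂[K] ^ n // ∃ u : 𝒪[K], Ideal.Quotient.mk (𝓂[K] ^ n) u = x ∧ Valued.v ((u : K) * σ u - r) ≤ Valued.v (ϖ ^ n)} =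
      Nat.card {x : 𝒪[K] ⧸ 𝓂[K] ^ n // ∃ u : 𝒪[K], Ideal.Quotient.mk (𝓂[K] ^ n) u = x ∧ Valued.v ((u : K) * σ u - r') ≤ Valued.v (ϖ ^ n)} := by
  have hz₀0 : z₀ ≠ 0 := fun h0 => by rw [h0, map_zero] at hz₀; exact zero_ne_one hz₀
  have hσz₀0 : Valued.v (σ z₀) ≠ 0 := by rw [hvσ, hz₀]; exact one_ne_zero
  set zO : 𝒪[K] := ⟨z₀, hz₀.le⟩ with hzO
  set wO : 𝒪[K] := ⟨z₀⁻¹, (by rw [map_inv₀, hz₀, inv_one] : Valued.v z₀⁻¹ ≤ 1)⟩ with hwO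
  have hzw : zO * wO = 1 := Subtype.ext (by simp [hzO, hwO, mul_inv_cancel₀ hz₀0])
  have hNz1 : Valued.v (z₀ * σ z₀) = 1 := by rw [map_mul, hvσ, hz₀, mul_one]
  have hNw1 : Valued.v (z₀⁻¹ * σ z₀⁻¹) = 1 := by rw [map_mul, hvσ, map_inv₀, hz₀, inv_one, mul_one]
  have hσz₀ne : σ z₀ ≠ 0 := (Valuation.ne_zero_iff _).1 hσz₀0
  have hNzw : (z₀ * σ z₀) * (z₀⁻¹ * σ z₀⁻¹) = 1 := by
    rw [map_inv₀, mul_mul_mul_comm, mul_inv_cancel₀ hz₀0, mul_inv_cancel₀ hσz₀ne, one_mul]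
  -- the bijection `x ↦ x · z̄₀` of the quotient ring
  set U : (𝒪[K] ⧸ 𝓂[K] ^ n)ˣ := Units.mkOfMulEqOne (Ideal.Quotient.mk (𝓂[K] ^ n) zO) (Ideal.Quotient.mk (𝓂[K] ^ n) wO)
    (by rw [← map_mul, hzw, map_one]) with hU
  have hUval : (U : 𝒪[K] ⧸ 𝓂[K] ^ n) = Ideal.Quotient.mk (𝓂[K] ^ n) zO := Units.val_mkOfMulEqOne _
  refine Nat.card_congr (U.mulRight.subtypeEquiv fun x => ⟨?_, ?_⟩)
  · rintro ⟨u, hux, hc⟩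
    refine ⟨u * zO, by rw [Units.mulRight_apply, hUval, map_mul, hux], ?_⟩
    have hcoe : ((u * zO : 𝒪[K]) : K) = (u : K) * z₀ := rfl
    have hrew : (u : K) * z₀ * σ ((u : K) * z₀) - r' = ((u : K) * σ u - r) * (z₀ * σ z₀) + (z₀ * σ z₀ * r - r') := by
      rw [map_mul]; ring
    rw [hcoe, hrew]
    refine (Valuation.map_add _ _ _).trans (max_le ?_ h)
    rw [map_mul, hNz1, mul_one]; exact hc
  · rintro ⟨u', hux, hc⟩
    refine ⟨u' * wO, ?_, ?_⟩
    · rw [map_mul, hux, Units.mulRight_apply, hUval, mul_assoc, ← map_mul, hzw, map_one, mul_one]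
    · have hcoe : ((u' * wO : 𝒪[K]) : K) = (u' : K) * z₀⁻¹ := rfl
      have hrew : (u' : K) * z₀⁻¹ * σ ((u' : K) * z₀⁻¹) - r =
          ((u' : K) * σ u' - r') * (z₀⁻¹ * σ z₀⁻¹) + (z₀⁻¹ * σ z₀⁻¹) * (r' - z₀ * σ z₀ * r) + r * ((z₀ * σ z₀) * (z₀⁻¹ * σ z₀⁻¹) - 1) := by
        rw [map_mul]; ring
      rw [hcoe, hrew, hNzw, sub_self, mul_zero, add_zero]
      refine (Valuation.map_add _ _ _).trans (max_le ?_ ?_)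
      · rw [map_mul, hNw1, mul_one]; exact hc
      · rw [map_mul, hNw1, one_mul, Valuation.map_sub_swap]; exact h
/-! ## §3 Below the conductor every fixed-unit fibre has the same size -/
/-- **BELOW THE CONDUCTOR THE GLUE COUNT IS CLASS-BLIND**: at a wild place (`|2| < 1`), for `a + 1 ≤ d` and every fixed unit `r`, `#Sol_{2a}(r) = #Sol_{2a}(1)` — every fixed unit is a norm to order
`2(d − 1) ≥ 2a` (★ `exists_unit_v_sub_mul_map_le`), then §2. [cite: Serre1979, Ch. V §3 Prop. 5, Cor. 2–3 pp. 84–86] [cite: LabesseLanglands1979, §2 p. 8] -/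
theorem natCard_normFibre_eq_natCard_normFibre_one_of_succ_le [Finite 𝓀[K]] (hD : IsRamifiedQuadraticDatum σ ϖ d t) (h2v : Valued.v (2 : K) < 1)
    {r : K} (hσr : σ r = r) (hr : Valued.v r = 1) {a : ℕ} (had : a + 1 ≤ d) :
    Nat.card {x : 𝒪[K] ⧸ 𝓂[K] ^ (2 * a) // ∃ u : 𝒪[K], Ideal.Quotient.mk (𝓂[K] ^ (2 * a)) u = x ∧ Valued.v ((u : K) * σ u - r) ≤ Valued.v (ϖ ^ (2 * a))} =
      Nat.card {x : 𝒪[K] ⧸ 𝓂[K] ^ (2 * a) // ∃ u : 𝒪[K], Ideal.Quotient.mk (𝓂[K] ^ (2 * a)) u = x ∧ Valued.v ((u : K) * σ u - 1) ≤ Valued.v (ϖ ^ (2 * a))} := by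
  have hvσ := hD.2.1; have hϖ := hD.2.2.1
  obtain ⟨z, hz1, hz⟩ := exists_unit_v_sub_mul_map_le hD h2v hσr hr
  symm
  refine natCard_normFibre_eq_of_approx hvσ (2 * a) hz1 ?_
  rw [mul_one, Valuation.map_sub_swap]
  refine hz.trans ?_
  rw [map_pow, v_varpi_pow hϖ, exp_le_exp]
  omega

/-! ## §4 At and above the conductor the fibre is norm-gated -/
/-- An exact norm `r = zσz` has `#Sol_n(r) = #Sol_n(1)` at every level. [cite: Serre1979, Ch. V §3] -/
theorem natCard_normFibre_eq_natCard_normFibre_one_of_exists (hvσ : ∀ a, Valued.v (σ a) = Valued.v a)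
    (n : ℕ) {r : K} (hr : Valued.v r = 1) (hex : ∃ z : K, z * σ z = r) :
    Nat.card {x : 𝒪[K] ⧸ 𝓂[K] ^ n // ∃ u : 𝒪[K], Ideal.Quotient.mk (𝓂[K] ^ n) u = x ∧ Valued.v ((u : K) * σ u - r) ≤ Valued.v (ϖ ^ n)} =
      Nat.card {x : 𝒪[K] ⧸ 𝓂[K] ^ n // ∃ u : 𝒪[K], Ideal.Quotient.mk (𝓂[K] ^ n) u = x ∧ Valued.v ((u : K) * σ u - 1) ≤ Valued.v (ϖ ^ n)} := by
  obtain ⟨z, hz⟩ := hex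
  have hz1 : Valued.v z = 1 := v_eq_one_of_v_mul_map_eq_one hvσ (by rw [hz, hr])
  symm
  refine natCard_normFibre_eq_of_approx hvσ n hz1 ?_
  rw [mul_one, hz, sub_self, map_zero]; exact zero_le

/-- **NON-NORMS HAVE EMPTY FIBRES AT AND ABOVE THE CONDUCTOR**: for `2d − 1 ≤ n` (`K` complete) and a fixed unit `r ∉ N(Kˣ)`, `#Sol_n(r) = 0` — a solution `u` would make `r∕(uσu)` a
fixed unit `≡ 1 (mod ϖ^{2d−1})`, hence a norm (★ `exists_mul_map_eq_of_fixed_of_v_sub_one_le_pred`). [cite: Serre1979, Ch. V §3 Cor. 3, Ch. XV §2] -/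
theorem natCard_normFibre_eq_zero_of_not_exists [CompleteSpace K] (hD : IsRamifiedQuadraticDatum σ ϖ d t)
    {r : K} (hσr : σ r = r) (hr : Valued.v r = 1) (hnot : ¬ ∃ z : K, z * σ z = r) {n : ℕ} (hn : 2 * d - 1 ≤ n) :
    Nat.card {x : 𝒪[K] ⧸ 𝓂[K] ^ n // ∃ u : 𝒪[K], Ideal.Quotient.mk (𝓂[K] ^ n) u = x ∧ Valued.v ((u : K) * σ u - r) ≤ Valued.v (ϖ ^ n)} = 0 := by
  have hσ := hD.1; have hϖ := hD.2.2.1; have hd1 := hD.2.2.2.2.2.1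
  haveI : IsEmpty {x : 𝒪[K] ⧸ 𝓂[K] ^ n // ∃ u : 𝒪[K], Ideal.Quotient.mk (𝓂[K] ^ n) u = x ∧ Valued.v ((u : K) * σ u - r) ≤ Valued.v (ϖ ^ n)} := by
    refine ⟨fun ⟨x, u, hux, hc⟩ => hnot ?_⟩
    have hn1 : 1 ≤ n := by omega
    have hlt : Valued.v ((u : K) * σ u - r) < Valued.v r := by rw [hr]; exact hc.trans_lt (v_varpi_pow_lt_one hϖ hn1)
    have hNu : Valued.v ((u : K) * σ u) = 1 := by rw [← hr]; exact Valuation.map_eq_of_sub_lt _ hlt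
    have hNu0 : (u : K) * σ u ≠ 0 := (Valuation.ne_zero_iff _).1 (by rw [hNu]; exact one_ne_zero)
    set w : K := r / ((u : K) * σ u) with hw
    have hσw : σ w = w := by rw [hw, map_div₀, hσr, map_mul_map hσ]
    have hw1 : Valued.v (w - 1) ≤ Valued.v ϖ ^ n := by
      rw [hw, div_sub_one hNu0, map_div₀, hNu, div_one, Valuation.map_sub_swap, ← map_pow]; exact hc
    obtain ⟨z, hz⟩ := exists_mul_map_eq_of_fixed_of_v_sub_one_le_pred hD hσw hn hw1
    refine ⟨z * u, ?_⟩
    calc z * (u : K) * σ (z * (u : K)) = (z * σ z) * ((u : K) * σ u) := by rw [map_mul]; ring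
      _ = w * ((u : K) * σ u) := by rw [hz]
      _ = r := div_mul_cancel₀ r hNu0
  exact Nat.card_of_isEmpty

/-! ## §5 The first value: `#Sol_2(1) = q` -/
/-- **`|uσu − 1| ≤ |ϖ|² ⟺ |u − 1| ≤ |ϖ|`** for an integer `u` at a wild place (`d ≥ 2`, `|2| ≤ |ϖ|`, residue characteristic `2`): `(1+m)(1+σm) − 1 = 2m + (σm − m) + mσm`, and
conversely `(u−1)² = (uσu − 1) + u(u − σu) − 2(u − 1)`. [cite: Serre1979, Ch. V §3 Prop. 5] -/
theorem v_mul_map_sub_one_le_iff (hD : IsRamifiedQuadraticDatum σ ϖ d t) (h2v : Valued.v (2 : K) < 1) {u : K} (hu : Valued.v u ≤ 1) :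
    Valued.v (u * σ u - 1) ≤ Valued.v (ϖ ^ 2) ↔ Valued.v (u - 1) ≤ Valued.v ϖ := by
  obtain ⟨hσ, hvσ, hϖ, hfix, hd, hd1, ht⟩ := hD
  have h2d : 2 ≤ d := two_le_of_v_two_lt_one hσ hvσ hfix hϖ hd ht h2v
  have hϖ1 : Valued.v ϖ < 1 := by rw [hϖ, ← exp_zero, exp_lt_exp]; norm_num
  have hϖle : Valued.v ϖ ≤ 1 := hϖ1.le
  have h2ϖ : Valued.v (2 : K) ≤ Valued.v ϖ := v_le_varpi_of_lt_one hϖ h2v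
  have hdle : Valued.v ϖ ^ d ≤ Valued.v (ϖ ^ 2) := by rw [map_pow]; exact pow_le_pow_right_of_le_one' hϖle h2d
  constructor
  · intro h
    have hsub : Valued.v (u * (u - σ u)) ≤ Valued.v (ϖ ^ 2) := by
      rw [map_mul]; exact (mul_le_of_le_one_left' hu).trans ((v_sub_map_le_of_v_le_one hσ hfix hϖ hd hu).trans hdle)
    have h2u : Valued.v (2 * (u - 1)) < 1 := by
      rw [map_mul]
      exact (mul_le_of_le_one_right' ((Valuation.map_sub _ _ _).trans (max_le hu (by rw [map_one])))).trans_lt h2v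
    have hsq : Valued.v ((u - 1) ^ 2) < 1 := by
      have hrew : (u - 1) ^ 2 = (u * σ u - 1) + u * (u - σ u) - 2 * (u - 1) := by ring
      rw [hrew]
      refine (Valuation.map_sub _ _ _).trans_lt (max_lt ((Valuation.map_add _ _ _).trans_lt (max_lt ?_ ?_)) h2u)
      · exact h.trans_lt (v_varpi_pow_lt_one hϖ (by norm_num))
      · exact hsub.trans_lt (v_varpi_pow_lt_one hϖ (by norm_num))
    have hlt : Valued.v (u - 1) < 1 := by
      rw [map_pow] at hsq
      by_contra hle
      exact absurd hsq (not_lt.2 (one_le_pow_of_one_le' (not_lt.1 hle) 2))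
    exact v_le_varpi_of_lt_one hϖ hlt
  · intro h
    set m := u - 1 with hm
    have hm1 : Valued.v m ≤ 1 := h.trans hϖle
    have hrew : u * σ u - 1 = 2 * m + (σ m - m) + m * σ m := by rw [hm, map_sub, map_one]; ring
    rw [hrew]
    have hϖ2 : Valued.v (ϖ ^ 2) = Valued.v ϖ * Valued.v ϖ := by rw [map_pow, sq]
    refine (Valuation.map_add _ _ _).trans (max_le ((Valuation.map_add _ _ _).trans (max_le ?_ ?_)) ?_)
    · rw [map_mul, hϖ2]; exact mul_le_mul' h2ϖ h
    · rw [Valuation.map_sub_swap]; exact (v_sub_map_le_of_v_le_one hσ hfix hϖ hd hm1).trans hdle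
    · rw [map_mul, hvσ, hϖ2]; exact mul_le_mul' h h

/-- **THE FIRST VALUE `#Sol_2(1) = q`**: the classes `x ∈ 𝒪 ⧸ 𝓂²` with `x·σ̄x ≡ 1` are exactly the `q` classes `≡ 1 (mod 𝓂)` (§5 criterion + ★ level lifting).
[cite: Serre1979, Ch. V §3 Prop. 5, Ch. IV §2 Prop. 6] [cite: LabesseLanglands1979, §2 p. 8] -/
theorem natCard_normFibre_one_two [IsDiscreteValuationRing 𝒪[K]] [Finite 𝓀[K]] (hD : IsRamifiedQuadraticDatum σ ϖ d t) (h2v : Valued.v (2 : K) < 1) :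
    Nat.card {x : 𝒪[K] ⧸ 𝓂[K] ^ 2 // ∃ u : 𝒪[K], Ideal.Quotient.mk (𝓂[K] ^ 2) u = x ∧ Valued.v ((u : K) * σ u - 1) ≤ Valued.v (ϖ ^ 2)} = Nat.card 𝓀[K] := by
  haveI : Finite (ResidueField 𝒪[K]) := inferInstanceAs (Finite 𝓀[K])
  have hϖ := hD.2.2.1
  -- rewrite the condition as `|u − 1| ≤ |ϖ|`
  have h1 : Nat.card {x : 𝒪[K] ⧸ 𝓂[K] ^ 2 // ∃ u : 𝒪[K], Ideal.Quotient.mk (𝓂[K] ^ 2) u = x ∧ Valued.v ((u : K) * σ u - 1) ≤ Valued.v (ϖ ^ 2)} =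
      Nat.card {x : 𝒪[K] ⧸ 𝓂[K] ^ 2 // ∃ u : 𝒪[K], Ideal.Quotient.mk (𝓂[K] ^ 2) u = x ∧ Valued.v ((u : K) - 1) ≤ Valued.v ϖ} :=
    Nat.card_congr (Equiv.subtypeEquivRight fun x => by
      constructor
      · rintro ⟨u, hux, hc⟩; exact ⟨u, hux, (v_mul_map_sub_one_le_iff hD h2v u.2).1 hc⟩
      · rintro ⟨u, hux, hc⟩; exact ⟨u, hux, (v_mul_map_sub_one_le_iff hD h2v u.2).2 hc⟩)
  rw [h1]
  -- lift the count from `𝓂¹` (the condition is constant on classes mod `𝓂`)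
  have hC : ∀ z z' : 𝒪[K], z - z' ∈ 𝓂[K] ^ 1 → (Valued.v ((z : K) - 1) ≤ Valued.v ϖ ↔ Valued.v ((z' : K) - 1) ≤ Valued.v ϖ) := by
    intro z z' hzz'
    rw [mem_maximalIdeal_pow_iff_v_le hϖ, pow_one] at hzz'
    have hzz'' : Valued.v ((z : K) - z') ≤ Valued.v ϖ := by simpa using hzz'
    constructor
    · intro h
      have hrew : (z' : K) - 1 = ((z : K) - 1) - ((z : K) - z') := by ring
      rw [hrew]; exact (Valuation.map_sub _ _ _).trans (max_le h hzz'')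
    · intro h
      have hrew : (z : K) - 1 = ((z' : K) - 1) + ((z : K) - z') := by ring
      rw [hrew]; exact (Valuation.map_add _ _ _).trans (max_le h hzz'')
  rw [natCard_lift_quotient_pow_eq_mul (R := 𝒪[K]) (k := 1) (m := 2) (by norm_num) (fun z : 𝒪[K] => Valued.v ((z : K) - 1) ≤ Valued.v ϖ) hC]
  -- the level-one count is `1`: the only class is that of `1`
  have hone : Nat.card {y : 𝒪[K] ⧸ 𝓂[K] ^ 1 // ∃ u : 𝒪[K], Ideal.Quotient.mk (𝓂[K] ^ 1) u = y ∧ Valued.v ((u : K) - 1) ≤ Valued.v ϖ} = 1 := by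
    rw [Nat.card_eq_one_iff_exists]
    refine ⟨⟨Ideal.Quotient.mk _ 1, 1, rfl, by simp⟩, ?_⟩
    rintro ⟨y, u, huy, hu⟩
    apply Subtype.ext
    change y = Ideal.Quotient.mk _ 1
    rw [← huy, Ideal.Quotient.eq, mem_maximalIdeal_pow_iff_v_le hϖ, pow_one]
    simpa using hu
  rw [hone, mul_one, show (2 : ℕ) - 1 = 1 from rfl, pow_one]

/-! ## §6 The lifting step `𝓂^{2a} → 𝓂^{2a+2}` -/
/-- **Traces of `𝓂^{2a}` lie in `𝓂^{2a+2}`** at a wild place: for `|u − u′| ≤ |ϖ^{2a}|` (`u′` an integer, `a ≥ 1`), `|uσu − u′σu′| ≤ |ϖ^{2a+2}|` — with `z = u − u′`,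
`uσu − u′σu′ = (zσu′ + σ(zσu′)) + zσz`, and a trace `c + σc = 2c + (σc − c)` of an element `c` of `𝓂^{2a}` has `|2c| ≤ |ϖ|^{2a+2}` (`t ≥ 2`), `|σc − c| ≤ |ϖ|^{2a+1}` (`d ≥ 2`),
upgraded to `2a + 2` because `c + σc` is fixed (even order). [cite: Serre1979, Ch. V §3 Prop. 5, Ch. III §3 Prop. 7] -/
theorem v_mul_map_sub_mul_map_le_pow_add_two (hD : IsRamifiedQuadraticDatum σ ϖ d t) (h2v : Valued.v (2 : K) < 1)
    {u u' : K} (hu' : Valued.v u' ≤ 1) {a : ℕ} (ha : 1 ≤ a) (h : Valued.v (u - u') ≤ Valued.v (ϖ ^ (2 * a))) :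
    Valued.v (u * σ u - u' * σ u') ≤ Valued.v (ϖ ^ (2 * a + 2)) := by
  obtain ⟨hσ, hvσ, hϖ, hfix, hd, hd1, ht⟩ := hD
  have h2d : 2 ≤ d := two_le_of_v_two_lt_one hσ hvσ hfix hϖ hd ht h2v
  have hϖ0 : ϖ ≠ 0 := fun h0 => by rw [h0, map_zero] at hϖ; exact exp_ne_zero hϖ.symm
  have hϖle : Valued.v ϖ ≤ 1 := by rw [hϖ, ← exp_zero, exp_le_exp]; norm_num
  -- write `u − u′ = ϖ^{2a} y` with `|y| ≤ 1`
  set z := u - u' with hz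
  have hz1 : Valued.v z ≤ Valued.v (ϖ ^ (2 * a)) := h
  set y := z / ϖ ^ (2 * a) with hy
  have hpow0 : ϖ ^ (2 * a) ≠ 0 := pow_ne_zero _ hϖ0
  have hzy : z = ϖ ^ (2 * a) * y := by rw [hy, mul_div_cancel₀ _ hpow0]
  have hy1 : Valued.v y ≤ 1 := by
    rw [hy, map_div₀]; exact div_le_one_of_le₀ hz1 zero_le
  -- `uσu − u′σu′ = zσu′ + u′σz + zσz`… as `u = u′ + z`
  have hu_eq : u = u' + z := by rw [hz]; ring
  have hrew : u * σ u - u' * σ u' = (z * σ u' + σ (z * σ u')) + z * σ z := by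
    rw [hu_eq, map_add, map_mul, hσ]; ring
  rw [hrew]
  -- (i) the norm term
  have hNz : Valued.v (z * σ z) ≤ Valued.v (ϖ ^ (2 * a + 2)) := by
    rw [map_mul, hvσ]
    calc Valued.v z * Valued.v z ≤ Valued.v (ϖ ^ (2 * a)) * Valued.v (ϖ ^ (2 * a)) := mul_le_mul' hz1 hz1
      _ = Valued.v (ϖ ^ (2 * a + 2 * a)) := by rw [← map_mul, ← pow_add]
      _ ≤ Valued.v (ϖ ^ (2 * a + 2)) := by
          rw [map_pow, map_pow]; exact pow_le_pow_right_of_le_one' hϖle (by omega)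
  -- (ii) the trace term `c + σc`, `c = zσu′ = ϖ^{2a}·(yσu′)`: `c + σc = 2c + (σc − c)`
  set c := z * σ u' with hc
  have hc_eq : c = ϖ ^ (2 * a) * (y * σ u') := by rw [hc, hzy]; ring
  have hw1 : Valued.v (y * σ u') ≤ 1 := by rw [map_mul, hvσ]; exact mul_le_one' hy1 hu'
  have hc1 : Valued.v c ≤ Valued.v (ϖ ^ (2 * a)) := by
    rw [hc_eq, map_mul]; exact mul_le_of_le_one_right' hw1
  have h2c : Valued.v (2 * c) ≤ Valued.v (ϖ ^ (2 * a + 2)) := by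
    have h2ϖ : Valued.v (2 : K) ≤ Valued.v (ϖ ^ 2) := by
      -- `t ≥ 2`: `t` is even (fixed `2`) and `t ≠ 0`
      have ht2 : 2 ≤ t := by
        have hte := even_t hfix hϖ ht
        have ht0 : t ≠ 0 := fun h0 => by rw [ht, h0, pow_zero] at h2v; exact lt_irrefl _ h2v
        obtain ⟨k, hk⟩ := hte; omega
      rw [ht, map_pow]; exact pow_le_pow_right_of_le_one' hϖle ht2
    rw [map_mul, pow_add, map_mul (Valued.v) (ϖ ^ (2 * a)), mul_comm]
    exact mul_le_mul' hc1 h2ϖ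
  -- `σc − c = σ(ϖ^{2a}) (σw − w) + (σ(ϖ^{2a}) − ϖ^{2a}) w`, `w = yσu′`
  set w := y * σ u' with hwdef
  have hσc : σ c - c = σ (ϖ ^ (2 * a)) * (σ w - w) + (σ (ϖ ^ (2 * a)) - ϖ ^ (2 * a)) * w := by
    rw [hc_eq, map_mul]; ring
  have hσϖpow : Valued.v (σ (ϖ ^ (2 * a))) = Valued.v (ϖ ^ (2 * a)) := hvσ _
  -- `|σw − w| ≤ |ϖ|^d ≤ |ϖ|²`
  have hσw : Valued.v (σ w - w) ≤ Valued.v ϖ ^ 2 := by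
    rw [Valuation.map_sub_swap]
    exact (v_sub_map_le_of_v_le_one hσ hfix hϖ hd hw1).trans (pow_le_pow_right_of_le_one' hϖle h2d)
  -- `|σ(ϖ^{2a}) − ϖ^{2a}| ≤ |ϖ|^{2a − 1} |ϖ|^d ≤ |ϖ|^{2a+1}`: by induction-free algebra `σ(ϖ^k) − ϖ^k` is divisible by `σϖ − ϖ`
  have hdiff : ∀ k : ℕ, Valued.v (σ (ϖ ^ k) - ϖ ^ k) ≤ Valued.v ϖ ^ k * Valued.v ϖ ^ (d - 1) := by
    intro k
    induction k with
    | zero => simp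
    | succ k ih =>
      have hrew : σ (ϖ ^ (k + 1)) - ϖ ^ (k + 1) = σ (ϖ ^ k) * (σ ϖ - ϖ) + (σ (ϖ ^ k) - ϖ ^ k) * ϖ := by simp only [map_pow]; ring
      rw [hrew]
      refine (Valuation.map_add _ _ _).trans (max_le ?_ ?_)
      · rw [map_mul, hvσ, map_pow, Valuation.map_sub_swap, hd, ← pow_add, ← pow_add]
        exact pow_le_pow_right_of_le_one' hϖle (by omega)
      · rw [map_mul]
        calc Valued.v (σ (ϖ ^ k) - ϖ ^ k) * Valued.v ϖ ≤ (Valued.v ϖ ^ k * Valued.v ϖ ^ (d - 1)) * Valued.v ϖ := mul_le_mul' ih le_rfl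
          _ = Valued.v ϖ ^ (k + 1) * Valued.v ϖ ^ (d - 1) := by rw [pow_succ, mul_right_comm]
  have hσϖdiff : Valued.v ((σ (ϖ ^ (2 * a)) - ϖ ^ (2 * a)) * w) ≤ Valued.v ϖ ^ (2 * a + 1) := by
    rw [map_mul]
    calc Valued.v (σ (ϖ ^ (2 * a)) - ϖ ^ (2 * a)) * Valued.v w ≤ (Valued.v ϖ ^ (2 * a) * Valued.v ϖ ^ (d - 1)) * 1 := mul_le_mul' (hdiff _) hw1
      _ = Valued.v ϖ ^ (2 * a + (d - 1)) := by rw [mul_one, pow_add]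
      _ ≤ Valued.v ϖ ^ (2 * a + 1) := pow_le_pow_right_of_le_one' hϖle (by omega)
  -- the fixed element `c + σc` then has value `≤ |ϖ|^{2a+1}`, upgraded to `2a+2` by parity
  have hsum_le : Valued.v (c + σ c) ≤ Valued.v ϖ ^ (2 * a + 1) := by
    have hrew : c + σ c = 2 * c + (σ c - c) := by ring
    rw [hrew]
    refine (Valuation.map_add _ _ _).trans (max_le (h2c.trans ?_) ?_)
    · rw [map_pow]; exact pow_le_pow_right_of_le_one' hϖle (by omega)
    · rw [hσc]
      refine (Valuation.map_add _ _ _).trans (max_le ?_ hσϖdiff)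
      rw [map_mul, hσϖpow, map_pow]
      calc Valued.v ϖ ^ (2 * a) * Valued.v (σ w - w) ≤ Valued.v ϖ ^ (2 * a) * Valued.v ϖ ^ 2 := mul_le_mul' le_rfl hσw
        _ = Valued.v ϖ ^ (2 * a + 2) := by rw [← pow_add]
        _ ≤ Valued.v ϖ ^ (2 * a + 1) := pow_le_pow_right_of_le_one' hϖle (by omega)
  have hfixsum : σ (c + σ c) = c + σ c := by rw [map_add, hσ, add_comm]
  have hsum : Valued.v (c + σ c) ≤ Valued.v (ϖ ^ (2 * a + 2)) := by
    have h' : Valued.v (c + σ c) ≤ exp (-(2 * (a : ℤ) + 1)) := by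
      have h0 := hsum_le; rw [v_varpi_pow hϖ] at h0
      have hcast : (-((2 * a + 1 : ℕ) : ℤ)) = -(2 * (a : ℤ) + 1) := by push_cast; ring
      rw [hcast] at h0; exact h0
    have h'' := v_le_exp_even_of_fixed hfix hfixsum (a : ℤ) h'
    rw [map_pow, v_varpi_pow hϖ]
    have hcast : (-((2 * a + 2 : ℕ) : ℤ)) = -(2 * (a : ℤ) + 2) := by push_cast; ring
    rw [hcast]; exact h''
  exact (Valuation.map_add _ _ _).trans (max_le hsum hNz)

/-- **THE LIFTING STEP**: for `a ≥ 1`, `#Sol_{2a+2}(1) = q² · #{x : 𝒪 ⧸ 𝓂^{2a} // ∃ u, mk u = x ∧ |uσu − 1| ≤ |ϖ^{2a+2}|}` — every one of the `q²` lifts of a class mod `𝓂^{2a}` has the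
same norm modulo `𝓂^{2a+2}` (§6 trace estimate), so the count lifts by ★ `natCard_lift_quotient_pow_eq_mul`. [cite: Serre1979, Ch. V §3 Prop. 5, Ch. II §4 Prop. 5] -/
theorem natCard_normFibre_one_succ [IsDiscreteValuationRing 𝒪[K]] [Finite 𝓀[K]] (hD : IsRamifiedQuadraticDatum σ ϖ d t) (h2v : Valued.v (2 : K) < 1)
    {a : ℕ} (ha : 1 ≤ a) :
    Nat.card {x : 𝒪[K] ⧸ 𝓂[K] ^ (2 * a + 2) // ∃ u : 𝒪[K], Ideal.Quotient.mk (𝓂[K] ^ (2 * a + 2)) u = x ∧ Valued.v ((u : K) * σ u - 1) ≤ Valued.v (ϖ ^ (2 * a + 2))} =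
      Nat.card 𝓀[K] ^ 2 *
        Nat.card {x : 𝒪[K] ⧸ 𝓂[K] ^ (2 * a) // ∃ u : 𝒪[K], Ideal.Quotient.mk (𝓂[K] ^ (2 * a)) u = x ∧ Valued.v ((u : K) * σ u - 1) ≤ Valued.v (ϖ ^ (2 * a + 2))} := by
  haveI : Finite (ResidueField 𝒪[K]) := inferInstanceAs (Finite 𝓀[K])
  have hϖ := hD.2.2.1; have hvσ := hD.2.1
  have hC : ∀ z z' : 𝒪[K], z - z' ∈ 𝓂[K] ^ (2 * a) →
      (Valued.v ((z : K) * σ z - 1) ≤ Valued.v (ϖ ^ (2 * a + 2)) ↔ Valued.v ((z' : K) * σ z' - 1) ≤ Valued.v (ϖ ^ (2 * a + 2))) := by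
    intro z z' hzz'
    rw [mem_maximalIdeal_pow_iff_v_le hϖ] at hzz'
    have hN := v_mul_map_sub_mul_map_le_pow_add_two hD h2v z'.2 ha (by simpa using hzz')
    have hN' : Valued.v ((z' : K) * σ z' - z * σ z) ≤ Valued.v (ϖ ^ (2 * a + 2)) := by rw [Valuation.map_sub_swap]; exact hN
    constructor
    · intro h
      have hrew : (z' : K) * σ z' - 1 = ((z' : K) * σ z' - z * σ z) + ((z : K) * σ z - 1) := by ring
      rw [hrew]; exact (Valuation.map_add _ _ _).trans (max_le hN' h)
    · intro h
      have hrew : (z : K) * σ z - 1 = ((z : K) * σ z - z' * σ z') + ((z' : K) * σ z' - 1) := by ring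
      rw [hrew]; exact (Valuation.map_add _ _ _).trans (max_le hN h)
  rw [natCard_lift_quotient_pow_eq_mul (R := 𝒪[K]) (k := 2 * a) (m := 2 * a + 2) (by omega)
    (fun z : 𝒪[K] => Valued.v ((z : K) * σ z - 1) ≤ Valued.v (ϖ ^ (2 * a + 2))) hC]
  rw [show 2 * a + 2 - 2 * a = 2 by omega]

end Literature.NumberTheory.LocalFields.WildQuadraticDatum

end
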